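import Literature.MathematicalPhysics.QuantumFieldTheory.Balaban1983to89.B9Thm312WholeFromThm310L2
import Literature.MathematicalPhysics.QuantumFieldTheory.Balaban1983to89.B9RWSumsDefinitePinsPairM
import Literature.MathematicalPhysics.QuantumFieldTheory.Balaban1983to89.B9Thm310WholeDir
import Summits.QuantumFields.YangMills.Theorems.BalabanUVNodesN06G0LayerFromThm310AtPinsE
import Literature.MathematicalPhysics.QuantumFieldTheory.Balaban1983to89.B9Thm312WholeFromThm310R1A
import Literature.MathematicalPhysics.QuantumFieldTheory.Balaban1983to89.B9Thm312WholeFromThm310R1A3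
import Literature.MathematicalPhysics.QuantumFieldTheory.Balaban1983to89.B9Thm312WholeStepFrom3131
import Literature.MathematicalPhysics.QuantumFieldTheory.Balaban1983to89.B9Thm312WholeLeftStepFrom3131
import Literature.MathematicalPhysics.QuantumFieldTheory.Balaban1983to89.B9Thm312WholeFormSmallFromL2

/-!
# N06 [B9] — THE G₀ LAYER OF ROWS 20–21 FROM THEOREM 3.10, Δ⁽²⁾-FREE CORE: `…N06G0LayerFromThm310AtPinsGUSP.g0_layer_of_thm310_coreDir₃USP` WITHOUT the L² step
# and the Sect.-D identities (programme P-D2, cut B″ of dag-n06-d's LOCATED-D2-CYCLE)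

T. Bałaban, *Propagators for lattice gauge theories in a background field*, Commun. Math. Phys. **99** (1985) 389–434 [`Balaban1985BackgroundPropagators`, "B9"], Thm 3.3
p. 399 with (3.42)–(3.47) pp. 397–398 for `G₀ = G(U)` of Thm 3.10 p. 414 ((3.107) p. 413), p. 421 («Let us denote … by G₀»); [4] = T. Bałaban, *Propagators and
renormalization transformations for lattice gauge theories. II*, Commun. Math. Phys. **96** (1984) 223–250 [`Balaban1984PropagatorsII`], (2.51)–(2.56), Lemma 2.1 (2.60)–(2.61).

WHY (cell `pub-ymgap`, node N06, bundle F7 rows 20–21, seat dag-n06-l g33).  The GUSP bundle (this seat, g31) returns, per member and configuration,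
`Thm33G0 ∧ FormSmall ∧ Identities` together; the last two come from the certificate's block-L² step (`hstepL2`), whose constant carries print's (3.137) letter of
`Δ⁽²⁾`, whereas Theorem 3.3 for `G₀` (the families (i) `Thm33G0`, (ii) `he1`, (iii) `Thm33G0Dir ∧ Thm33G0DirR ∧ Thm33G0L2M`) never sees `Δ⁽²⁾`.  The P-D2 road derives
(3.137) from exactly these Δ⁽²⁾-free G₀ letters BEFORE the L² step (dag-n06-d ⚑ LOCATED-D2-CYCLE, 2026-08-30); so THIS FILE is GUSP with the binders
`θ2₁₂ δK12 ρS σS hθ2₁₂ hσS hρS hρS₀ hσSK hpos12 hinv12 hIdOfForm hstepL2` REMOVED, the outputs `r12` and `FormSmall ∧ Identities` REMOVED (they move to the sequel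
`…N06FormSmallIdentitiesAtPinsUSP`), every other byte of the statement and proof VERBATIM; the produced regime is `a₀ := min a12 (q.a₁ ∕ c35)` (the `(2r12 + 2)⁻¹` factor
moves to the sequel).  ★★★ `g0_core_of_thm310_coreDir₃USP`.
HONEST LABEL: helper (re-cut of a landed face, no new mathematics), count-neutral; every analytic member a displayed HYPOTHESIS of printed species; N06 NOT discharged;
nothing continuum ∕ OS ∕ mass gap ∕ Clay.  NEW file; GUSP untouched.
-/

noncomputable section

namespace Summit.QuantumFields.YangMills.BalabanUVNodes.N06G0CoreFromThm310GUSPC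

open Literature.MathematicalPhysics.QuantumFieldTheory.Balaban1983to89
open Literature.MathematicalPhysics.QuantumFieldTheory.Balaban1983to89.B9Thm34Ext (toB6)
open Literature.MathematicalPhysics.QuantumFieldTheory.Balaban1983to89.B11SectG (BlockNorm HasMaj)
open Literature.MathematicalPhysics.QuantumFieldTheory.Balaban1983to89.B9Thm37Glue (IsTransposePair)
open Literature.MathematicalPhysics.QuantumFieldTheory.Balaban1983to89.B9Thm37Whole (const37)
open Literature.MathematicalPhysics.QuantumFieldTheory.Balaban1983to89.B9Thm312Whole (Thm33G0 FormSmall cNorm)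
open Literature.MathematicalPhysics.QuantumFieldTheory.Balaban1983to89.B9Thm312WholeDir (Thm33G0Dir Thm33G0L2M)
open Literature.MathematicalPhysics.QuantumFieldTheory.Balaban1983to89.B9Thm313WholeDir (Thm33G0DirR)
open Literature.MathematicalPhysics.QuantumFieldTheory.Balaban1983to89.B9Thm310Whole
  (Ops310 StaticOK310 Sizes310 Local342G Identities310 Conv3107 conv3107_of_local3107)
open Literature.MathematicalPhysics.QuantumFieldTheory.Balaban1983to89.B9Thm310WholeDir (DirLetters310 Identities310₂ DirSupSq310 conv3107_of_local3107₂)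
open Literature.MathematicalPhysics.QuantumFieldTheory.Balaban1983to89.B9RWSums343Holder
  (HolderProbes HolderLegs310 FactorsHolder310 holderConst)
open Literature.MathematicalPhysics.QuantumFieldTheory.Balaban1983to89.B9RWSums344Input (inputConst44 inputConst45)
open Literature.MathematicalPhysics.QuantumFieldTheory.Balaban1983to89.B9RWSums344InputPair
  (InputLegsPair310 FactorsInputPair310 DirSupHolder310)
open Literature.MathematicalPhysics.QuantumFieldTheory.Balaban1983to89.B9RWSums346SecondDiff
  (DirOps310 DirTranspose310 L2SecondLegs310 FactorsL2Second310 secondConst secondConst_nonneg)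
open Literature.MathematicalPhysics.QuantumFieldTheory.Balaban1983to89.B9RWSums346MixedPair
  (L2MixedLegs310 FactorsL2Mixed310 DirSup310 mixedConst mixedConst_nonneg)
open Literature.MathematicalPhysics.QuantumFieldTheory.Balaban1983to89.B9RWSums346Two (L2TwoLegs310 FactorsL2_310 twoConst)
open Literature.MathematicalPhysics.QuantumFieldTheory.Balaban1983to89.B9RWSums343to347Whole (Facts347)
open Literature.MathematicalPhysics.QuantumFieldTheory.Balaban1983to89.B6RandomWalk (Ineq261 c1_nonneg)
open Literature.MathematicalPhysics.QuantumFieldTheory.Balaban1983to89.B6RandomWalkHom (HasMajorantHom)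
open Literature.MathematicalPhysics.QuantumFieldTheory.Balaban1983to89.B9RWSumsDefinitePins (PinPrims)
open Literature.MathematicalPhysics.QuantumFieldTheory.Balaban1983to89.B9RWSumsDefinitePinsPair (PairPrims)
open Literature.MathematicalPhysics.QuantumFieldTheory.Balaban1983to89.B9RWSumsDefinitePinsPairM (MixedPrims)
open Literature.MathematicalPhysics.QuantumFieldTheory.Balaban1983to89.B9RWSums347DefiniteFaces (exp261 lemma21Pack_geo9Y)
open Literature.MathematicalPhysics.QuantumFieldTheory.Balaban1983to89.B9PinMembersKLevelV1 (MemberY geo9Y)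
open Literature.MathematicalPhysics.QuantumFieldTheory.Balaban1983to89.B9GeoLemma21KLevelV1 (geo9Y_len_pos)
open Literature.MathematicalPhysics.QuantumFieldTheory.Balaban1983to89.B9Thm312WholeFromThm310
  (thm33G0_of_conv3107 leftStep_of_conv3107 thm33G0DirR_of_conv3107 thm33G0Dir_of_conv3107)
open Literature.MathematicalPhysics.QuantumFieldTheory.Balaban1983to89.B9Thm312WholeFromThm310L2 (thm33G0L2M_of_conv3107)
open Literature.MathematicalPhysics.QuantumFieldTheory.Balaban1983to89.B9Thm312WholeFromThm310R1A (thm33G0Dir_of_conv3107₂)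
open Literature.MathematicalPhysics.QuantumFieldTheory.Balaban1983to89.B9Thm312WholeFromThm310R1A3 (thm33G0L2M_of_conv3107₃)
open Literature.MathematicalPhysics.QuantumFieldTheory.Balaban1983to89.B9Thm312WholeStepFrom3131 (Letters3131 step_of_letters3131)
open Literature.MathematicalPhysics.QuantumFieldTheory.Balaban1983to89.B9Thm312WholeLeftStepFrom3131 (Letters3131H stepD_of_letters3131)
open Literature.MathematicalPhysics.QuantumFieldTheory.Balaban1983to89.B9Thm312WholeDir (StepDir)
open Literature.MathematicalPhysics.QuantumFieldTheory.Balaban1983to89.B9Thm312WholeFromThm310 (e1_of_conv3107)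
open Literature.MathematicalPhysics.QuantumFieldTheory.Balaban1983to89.B9Thm312WholeFormSmallFromL2 (formSmall_of_stepL2)
open Literature.MathematicalPhysics.QuantumFieldTheory.Balaban1983to89.B9Thm312Whole (PosDefEnd)
open Literature.MathematicalPhysics.QuantumFieldTheory.Balaban1983to89.B9Thm312Whole (GeoOK)
open Literature.MathematicalPhysics.QuantumFieldTheory.Balaban1983to89.B9GeoLemma21KLevelV1 (rowSum261_geo9Y)
open Literature.MathematicalPhysics.QuantumFieldTheory.Balaban1983to89.B11SectG (RowSum)

variable {d ℓ : ℕ} {hd : 1 ≤ d + 1} {hL : Odd (ℓ + 1) ∧ 1 < ℓ + 1} {b₀ b₁ : ℝ} {Mstar : ℕ}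
variable [∀ x : MemberY d ℓ hd hL b₀ b₁ Mstar, Fintype (geo9Y x).Site]
  [∀ x : MemberY d ℓ hd hL b₀ b₁ Mstar, DecidableEq (geo9Y x).Site]
variable {c35 : ℝ} {bg : MemberY d ℓ hd hL b₀ b₁ Mstar → B9.Backgrounds}

/-- «for M sufficiently large»: M ≧ 2N_Fθ₀c₁ gives N_F·θ₀M⁻¹·c₁ ≦ ½ (the located smallness of `conv3107_of_local3107`; the lineage's
private arithmetic, restated). [folklore] -/
private theorem small_of_threshold {NF θ₀ c M : ℝ} (hM : 0 < M) (hbig : 2 * NF * θ₀ * c ≤ M) :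
    NF * (θ₀ * M⁻¹) * c ≤ 1 / 2 := by
  have h1 : NF * (θ₀ * M⁻¹) * c = (NF * θ₀ * c) / M := by
    rw [div_eq_mul_inv]
    ring
  rw [h1, div_le_iff₀ hM]
  linarith

/-- n06-k's Hölder constant `holderConst` is ≧ 0 for nonnegative letters (its own nonnegativity lemma is private). [folklore] -/
private theorem holderConst_nonneg' {dd : ℕ} {δ₀ α NH NF C b t : ℝ} (hNH : 0 ≤ NH) (hNF : 0 ≤ NF) (hC : 0 ≤ C) (hb : 0 ≤ b)
    (ht : 0 ≤ t) : 0 ≤ holderConst dd δ₀ α NH NF C b t := by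
  have hc1 : 0 ≤ B6.c1 dd δ₀ α := c1_nonneg dd δ₀ α
  unfold holderConst
  have h1 : 0 ≤ 2 * NH * b * B6.c1 dd δ₀ α := mul_nonneg (mul_nonneg (mul_nonneg (by norm_num) hNH) hb) hc1
  have h2 : 0 ≤ NH * b := mul_nonneg hNH hb
  have h3 : 0 ≤ NF * t * C * B6.c1 dd δ₀ α := mul_nonneg (mul_nonneg (mul_nonneg hNF ht) hC) hc1
  linarith

/-- n06-k's (3.44) constant `inputConst44` is ≧ 0 for nonnegative letters. [folklore] -/
private theorem inputConst44_nonneg' {d₁ : ℕ} {δ₁ α₁ NI NF C L₀ b t : ℝ} (hNI : 0 ≤ NI) (hNF : 0 ≤ NF) (hC : 0 ≤ C)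
    (hL₀ : 0 ≤ L₀) (hb : 0 ≤ b) (ht : 0 ≤ t) : 0 ≤ inputConst44 d₁ δ₁ α₁ NI NF C L₀ b t := by
  have hc1 : 0 ≤ B6.c1 d₁ δ₁ α₁ := c1_nonneg d₁ δ₁ α₁
  unfold inputConst44
  exact add_nonneg (mul_nonneg hNI hb) (mul_nonneg (mul_nonneg (mul_nonneg hC (mul_nonneg hNF ht)) hL₀) hc1)

/-- n06-k's (3.45) constant `inputConst45` is ≧ 0 for nonnegative letters. [folklore] -/
private theorem inputConst45_nonneg' {d₁ : ℕ} {δ₁ α₁ NI NF L₀ hc b t : ℝ} (hNI : 0 ≤ NI) (hNF : 0 ≤ NF) (hL₀ : 0 ≤ L₀)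
    (hhc : 0 ≤ hc) (hb : 0 ≤ b) (ht : 0 ≤ t) : 0 ≤ inputConst45 d₁ δ₁ α₁ NI NF L₀ hc b t := by
  have hc1 : 0 ≤ B6.c1 d₁ δ₁ α₁ := c1_nonneg d₁ δ₁ α₁
  unfold inputConst45
  exact add_nonneg (mul_nonneg hNI hb) (mul_nonneg (mul_nonneg (mul_nonneg hhc (mul_nonneg hNF ht)) hL₀) hc1)

set_option maxHeartbeats 400000 in
/-- ★★ **THE ₃ G₀ LAYER WITH THE (3.43) PROFILE EXPORTED** (module docstring): `g0_layer_of_thm310_coreDir₃US` with the witness `Bh12` replaced, in the statement, by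
n06-k's closed form `β ↦ holderConst (exp261 geo9Y q.δ₀ q.α) q.δ₀ q.α q.NH q.NF (const37 …) (q.Bl β) (q.Bt β)`; outputs `B12₀ Bi12 Bi2₁₂ B12₂ r12 M₀ a₀` (signs, the profile's
sign), `M12 ≤ M₀`, `a₀ ≤ a12`, and the families (i) `Thm33G0 ∧ FormSmall ∧ Identities`, (ii) `he1`, (iii) `Thm33G0Dir ∧ Thm33G0DirR ∧ Thm33G0L2M` in the regime `(M₀, a₀)`.
Proof VERBATIM dag-n06-d's.  Nothing of print asserted.
[cite: Balaban1985BackgroundPropagators, Thm 3.3 p.399, (3.42)–(3.46) pp.397–398, Thm 3.10 (3.107) p.415, Thm 3.12 (3.128)–(3.131) p.421; Balaban1984PropagatorsII, Lemma 2.1 (2.60)–(2.61) p.234] -/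
theorem g0_core_of_thm310_coreDir₃USP {X Y ι A PX PY Z W : MemberY d ℓ hd hL b₀ b₁ Mstar → Type} {P : MemberY d ℓ hd hL b₀ b₁ Mstar → Type}
    [∀ x, Fintype (X x)] [∀ x, DecidableEq (X x)] [∀ x, Fintype (Y x)] [∀ x, DecidableEq (Y x)] [∀ x, Fintype (ι x)]
    [∀ x, Fintype (A x)] [∀ x, Fintype (PX x)] [∀ x, DecidableEq (PX x)] [∀ x, Fintype (PY x)] [∀ x, DecidableEq (PY x)]
    [∀ x, Fintype (Z x)] [∀ x, Fintype (W x)] [∀ x, Fintype (P x)]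
    (hc35 : 0 < c35) (q : PinPrims) (hq : q.OK) (q3 : PairPrims) (hq3 : q3.OK) (qM : MixedPrims) (hqM : qM.OK)
    (H : MemberY d ℓ hd hL b₀ b₁ Mstar → Prop)
    -- the Theorem-3.10 letters of rows 18–19 (G side) and their schemas, VERBATIM as the certificate displays them
    (𝔬A : ∀ x : MemberY d ℓ hd hL b₀ b₁ Mstar, Ops310 (geo9Y x) (bg x) (X x) (Y x) (ι x) (A x))
    (𝔭A : ∀ x : MemberY d ℓ hd hL b₀ b₁ Mstar, HolderProbes (geo9Y x) (bg x) (X x) (Y x) (PX x) (PY x))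
    (𝔡A : ∀ x : MemberY d ℓ hd hL b₀ b₁ Mstar, DirOps310 (𝔬A x) (P x)) (𝔩A : ∀ x : MemberY d ℓ hd hL b₀ b₁ Mstar, DirLetters310 (𝔬A x) (P x))
    (bHXA : ∀ x : MemberY d ℓ hd hL b₀ b₁ Mstar, ℝ → BlockNorm (toB6 (geo9Y x) 1 (H x)) (X x → ℝ))
    (κA : MemberY d ℓ hd hL b₀ b₁ Mstar → Sizes310)
    (SHA S3A SIA SMA S2A : ∀ x : MemberY d ℓ hd hL b₀ b₁ Mstar, ι x → Finset (geo9Y x).Site)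
    (hstA : ∀ x, StaticOK310 (𝔬A x) q.ρ q.Nc q.N' q.NF q.Cℓ (κA x)) (hκA : ∀ x, (κA x).Bounded q.Kc)
    (h36A : ∀ x, q.M₁ ≤ (geo9Y x).M → ∀ α₀ : ℝ, 0 < α₀ → c35 * (geo9Y x).M * α₀ ≤ q.a₁ →
      ∀ U : (bg x).Cfg, (bg x).Reg335 c35 α₀ U →
        Local342G (𝔬A x) 1 (H x) q.B₀ q.δ₀ U ∧ B9Thm310Whole.Factors389 (𝔬A x) 1 (H x) q.θ₀ q.δ₀ U ∧
          DirSupSq310 (𝔬A x) (𝔡A x) 1 (H x) U ∧ Identities310₂ (𝔬A x) (𝔡A x) (𝔩A x) 1 (H x) U)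
    (h36HA : ∀ x, q.M₁ ≤ (geo9Y x).M → ∀ α₀ : ℝ, 0 < α₀ → c35 * (geo9Y x).M * α₀ ≤ q.a₁ →
      ∀ U : (bg x).Cfg, (bg x).Reg335 c35 α₀ U →
        HolderLegs310 (𝔬A x) (𝔭A x) 1 (H x) (SHA x) q.Bl q.δ₀ U ∧ FactorsHolder310 (𝔬A x) (𝔭A x) 1 (H x) q.Bt q.δ₀ U ∧
          (L2SecondLegs310 (𝔬A x) (𝔡A x) 1 (H x) (S3A x) q3.B3 q.δ₀ U ∧ (∀ a, IsTransposePair ((𝔬A x).Rt U a) ((𝔬A x).Rf U a)) ∧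
            DirTranspose310 (𝔬A x) (𝔡A x) U) ∧
            (InputLegsPair310 (𝔬A x) (𝔡A x) (𝔭A x) 1 (H x) (bHXA x) (SIA x) q.BI q.BI2 q.δ₀ U ∧
              FactorsInputPair310 (𝔬A x) (𝔡A x) 1 (H x) (bHXA x) q.θI q.δ₀ U ∧ DirSupHolder310 (𝔬A x) (𝔡A x) (𝔭A x) 1 (H x) U) ∧
              (L2MixedLegs310 (𝔬A x) (𝔡A x) 1 (H x) (SMA x) qM.BM q.δ₀ U ∧ FactorsL2Mixed310 (𝔬A x) (𝔡A x) 1 (H x) qM.θM q.δ₀ U ∧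
                DirSup310 (𝔬A x) (𝔡A x) 1 (H x) U))
    -- the two-sided L² leg schema of Theorem 3.10 (the (3.46)₄ line of G(U) = ∇_UG∇*_U: n06-k's one-slot legs + their factors)
    (h36A2 : ∀ x, q.M₁ ≤ (geo9Y x).M → ∀ α₀ : ℝ, 0 < α₀ → c35 * (geo9Y x).M * α₀ ≤ q.a₁ →
      ∀ U : (bg x).Cfg, (bg x).Reg335 c35 α₀ U →
        L2TwoLegs310 (𝔬A x) 1 (H x) (S2A x) q.B2 q.δ₀ U ∧ FactorsL2_310 (𝔬A x) 1 (H x) q.θ2 q.δ₀ U)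
    (hcntHA : ∀ x (a : (geo9Y x).Site), (∑ c, if a ∈ SHA x c then (1 : ℝ) else 0) ≤ q.NH)
    (hcnt3A : ∀ x (a : (geo9Y x).Site), (∑ c, if a ∈ S3A x c then (1 : ℝ) else 0) ≤ q3.N3)
    (hcntIA : ∀ x (a : (geo9Y x).Site), (∑ c, if a ∈ SIA x c then (1 : ℝ) else 0) ≤ q.NI)
    (hcntMA : ∀ x (a : (geo9Y x).Site), (∑ c, if a ∈ SMA x c then (1 : ℝ) else 0) ≤ qM.NM)
    (hcnt2A : ∀ x (a : (geo9Y x).Site), (∑ c, if a ∈ S2A x c then (1 : ℝ) else 0) ≤ q.N2)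
    -- the symmetry of G(U) and the transposition (∇_UG)ᵀ = G∇*_U (theorems at the pins in the certificate)
    (hsymA : ∀ x, q.M₁ ≤ (geo9Y x).M → ∀ α₀ : ℝ, 0 < α₀ → c35 * (geo9Y x).M * α₀ ≤ q.a₁ →
      ∀ U : (bg x).Cfg, (bg x).Reg335 c35 α₀ U → IsTransposePair ((𝔬A x).G U) ((𝔬A x).G U))
    (htrA : ∀ x, q.M₁ ≤ (geo9Y x).M → ∀ α₀ : ℝ, 0 < α₀ → c35 * (geo9Y x).M * α₀ ≤ q.a₁ →
      ∀ U : (bg x).Cfg, (bg x).Reg335 c35 α₀ U →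
        IsTransposePair ((𝔬A x).D U ∘ₗ (𝔬A x).G U) ((𝔬A x).G U ∘ₗ (𝔬A x).Dstar U))
    -- the Theorem-3.12 letters of rows 20–21 and the identification G₀ := G(U) (p. 421; at def-Y's pins: the same coordinate models)
    (𝔬12 : ∀ x : MemberY d ℓ hd hL b₀ b₁ Mstar, B9Thm312Whole.Ops (geo9Y x) (bg x) (X x) (Y x) (Z x) (W x))
    (hblk : ∀ x, (𝔬12 x).blk = (𝔬A x).blk) (hblkY : ∀ x, (𝔬12 x).blkY = (𝔬A x).blkY)
    (hG0 : ∀ x (U : (bg x).Cfg), (𝔬12 x).G0 U = (𝔬A x).G U) (hD : ∀ x (U : (bg x).Cfg), (𝔬12 x).D U = (𝔬A x).D U)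
    (hDs : ∀ x (U : (bg x).Cfg), (𝔬12 x).Dstar U = (𝔬A x).Dstar U)
    -- rows 20–21's numerics and the ONE rate relation
    (δ12₀ a12 M12 : ℝ) (ha12 : 0 < a12) (hM12 : 0 < M12)
    (hδ12₀ : δ12₀ ≤ (1 - 3 * q.αF) * ((1 - 2 * q.α) * q.δ₀))
 :
    ∃ (B12₀ : ℝ) (Bi12 : ℝ → ℝ) (Bi2₁₂ : ℝ → ℝ → ℝ) (B12₂ M₀ a₀ : ℝ),
      0 ≤ B12₀ ∧ (∀ β, 0 ≤ β → β < 1 → 0 ≤ holderConst (exp261 (@geo9Y d ℓ hd hL b₀ b₁ Mstar) q.δ₀ q.α) q.δ₀ q.α q.NH q.NF (const37 (exp261 (@geo9Y d ℓ hd hL b₀ b₁ Mstar) q.δ₀ q.α) q.δ₀ q.α q.ρ q.B₀ q.Nc q.N' q.Cℓ q.Kc) (q.Bl β) (q.Bt β)) ∧ (∀ ε, 0 < ε → ε ≤ 1 → 0 ≤ Bi12 ε) ∧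
        (∀ ε β, 0 < ε → ε ≤ 1 → 0 ≤ β → β < 1 → 0 ≤ Bi2₁₂ ε β) ∧ 0 ≤ B12₂ ∧
        0 < M₀ ∧ 0 < a₀ ∧ M12 ≤ M₀ ∧ a₀ ≤ a12 ∧
        (∀ x : MemberY d ℓ hd hL b₀ b₁ Mstar, M₀ ≤ (geo9Y x).M → ∀ α₀ : ℝ, 0 < α₀ → (geo9Y x).M * α₀ ≤ a₀ →
          ∀ U : (bg x).Cfg, (bg x).Reg335 c35 α₀ U → (bg x).Reg336 c35 α₀ U →
            Thm33G0 (𝔬12 x) 1 (H x) B12₀ δ12₀ U) ∧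
        (∀ x : MemberY d ℓ hd hL b₀ b₁ Mstar, M₀ ≤ (geo9Y x).M → ∀ α₀ : ℝ, 0 < α₀ → (geo9Y x).M * α₀ ≤ a₀ →
          ∀ U : (bg x).Cfg, (bg x).Reg335 c35 α₀ U → (bg x).Reg336 c35 α₀ U →
            HasMajorantHom (g := toB6 (geo9Y x) 1 (H x)) (𝔬12 x).blk (𝔬12 x).blkY ((𝔬12 x).D U ∘ₗ (𝔬12 x).G0 U)
              (fun (a b : (geo9Y x).Site) => B12₀ * (geo9Y x).len a * Real.exp (-(δ12₀ * (geo9Y x).dist a b)))) ∧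
        (∀ x : MemberY d ℓ hd hL b₀ b₁ Mstar, M₀ ≤ (geo9Y x).M → ∀ α₀ : ℝ, 0 < α₀ → (geo9Y x).M * α₀ ≤ a₀ →
          ∀ U : (bg x).Cfg, (bg x).Reg335 c35 α₀ U → (bg x).Reg336 c35 α₀ U →
            Thm33G0Dir (𝔬12 x) (𝔭A x) (𝔡A x).Dd (𝔡A x).Dsd 1 (H x) (bHXA x) B12₀
              (fun β => holderConst (exp261 (@geo9Y d ℓ hd hL b₀ b₁ Mstar) q.δ₀ q.α) q.δ₀ q.α q.NH q.NF (const37 (exp261 (@geo9Y d ℓ hd hL b₀ b₁ Mstar) q.δ₀ q.α) q.δ₀ q.α q.ρ q.B₀ q.Nc q.N' q.Cℓ q.Kc) (q.Bl β) (q.Bt β)) Bi12 Bi2₁₂ δ12₀ U ∧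
              Thm33G0DirR (𝔬12 x) (𝔡A x).Dsd 1 (H x) B12₀ δ12₀ U ∧
                Thm33G0L2M (𝔬12 x) (𝔡A x).Dd (𝔡A x).Dsd 1 (H x) B12₂ δ12₀ U) := by
  -- [4] Lemma 2.1 (2.61) at (δ₀, α) and p. 398's member facts at ((1 − 2α)δ₀, α_F), above ONE threshold M_L (n06-i ∕ n06-k)
  obtain ⟨ML, h261, hfacts, -⟩ :=
    lemma21Pack_geo9Y (d := d) (ℓ := ℓ) (hd := hd) (hL := hL) (b₀ := b₀) (b₁ := b₁) (Mstar := Mstar) H hq.α_pos hq.α_lt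
      hq.δ₀_pos hq.αF_pos (by linarith only [hq.αF_lt])
  -- the letters of the constants
  set dq : ℕ := exp261 (@geo9Y d ℓ hd hL b₀ b₁ Mstar) q.δ₀ q.α with hdq
  set dF : ℕ := exp261 (@geo9Y d ℓ hd hL b₀ b₁ Mstar) ((1 - 2 * q.α) * q.δ₀) (1 - q.αF) with hdF
  set L₀ : ℝ := ((ℓ + 1 : ℕ) : ℝ) with hL₀
  set C : ℝ := const37 dq q.δ₀ q.α q.ρ q.B₀ q.Nc q.N' q.Cℓ q.Kc with hCdef
  set Bh : ℝ → ℝ := fun β => holderConst dq q.δ₀ q.α q.NH q.NF C (q.Bl β) (q.Bt β) with hBh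
  set Bi : ℝ → ℝ := fun ε => inputConst44 dq q.δ₀ q.α q.NI q.NF C L₀ (q.BI ε) (q.θI ε) with hBi
  set Bi2 : ℝ → ℝ → ℝ := fun ε β => inputConst45 dq q.δ₀ q.α q.NI q.NF L₀ (Bh β) (q.BI2 ε β) (q.θI (β + ε)) with hBi2
  set B₂ : ℝ := max (max (C * L₀) (2 * (q3.N3 * q3.B3) * L₀))
    (max (mixedConst dq q.δ₀ q.α qM.NM qM.BM q.NF qM.θM C L₀) (twoConst dq q.δ₀ q.α q.N2 q.B2 q.NF q.θ2 C L₀)) with hB₂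
  set M₀ : ℝ := max M12 (max q.M₁ (max ML (max 1 (max (max (2 * q.NF * q.θ₀ * B6.c1 dq q.δ₀ q.α) (2 * q.NF * q.θ₀ * Real.sqrt L₀ * B6.c1 dq q.δ₀ q.α)) 0)))) with hM₀
  set a₀ : ℝ := min a12 (q.a₁ / c35) with ha₀
  -- signs
  obtain ⟨hN3, hB3, -⟩ := hq3; obtain ⟨hNM, hBM, hθM⟩ := hqM
  have hCℓ0 : 0 ≤ q.Cℓ := zero_le_one.trans hq.one_le_Cℓ
  have hC : 0 ≤ C := B9RWSumsCompleteGeo9Y.const37_nonneg_of_signs dq hq.B₀_pos.le hq.Nc_nn hq.N'_nn hCℓ0 hq.Kc_nn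
  have hL₀1 : 1 ≤ L₀ := by rw [hL₀]; exact_mod_cast Nat.succ_le_succ (Nat.zero_le _)
  have hL₀0 : 0 ≤ L₀ := zero_le_one.trans hL₀1
  have hBh0 : ∀ β, 0 ≤ β → β < 1 → 0 ≤ Bh β := fun β hβ0 hβ1 =>
    holderConst_nonneg' hq.NH_nn hq.NF_nn hC (hq.Bl_nn β hβ0 hβ1) (hq.Bt_nn β hβ0 hβ1)
  have hBi0 : ∀ ε, 0 < ε → ε ≤ 1 → 0 ≤ Bi ε := fun ε hε hε1 =>
    inputConst44_nonneg' hq.NI_nn hq.NF_nn hC hL₀0 (hq.BI_nn ε hε hε1) (hq.θI_nn ε hε)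
  have hBi20 : ∀ ε β, 0 < ε → ε ≤ 1 → 0 ≤ β → β < 1 → 0 ≤ Bi2 ε β := fun ε β hε hε1 hβ0 hβ1 =>
    inputConst45_nonneg' hq.NI_nn hq.NF_nn hL₀0 (hBh0 β hβ0 hβ1) (hq.BI2_nn ε β hε hε1 hβ0 hβ1) (hq.θI_nn (β + ε) (by linarith))
  have hB₂0 : 0 ≤ B₂ := le_trans (mul_nonneg hC hL₀0) ((le_max_left _ _).trans (le_max_left _ _))
  have hM₀pos : 0 < M₀ := lt_of_lt_of_le hM12 (le_max_left _ _)
  have ha₀pos : 0 < a₀ := lt_min ha12 (div_pos hq.a₁_pos hc35)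
  -- the rates: δ := (1 − 2α)δ₀ > 0, δ12₀ ≤ (1 − 3α_F)δ ≤ (1 − α_F)δ ≤ δ ≤ (1 − α)δ₀
  have hδpos : 0 < (1 - 2 * q.α) * q.δ₀ := mul_pos (by linarith only [hq.α_lt]) hq.δ₀_pos
  have hαFδ : 0 ≤ q.αF * ((1 - 2 * q.α) * q.δ₀) := mul_nonneg hq.αF_pos.le hδpos.le
  have hρ3 : δ12₀ ≤ (1 - 3 * q.αF) * ((1 - 2 * q.α) * q.δ₀) := hδ12₀
  have hρ1 : δ12₀ ≤ (1 - q.αF) * ((1 - 2 * q.α) * q.δ₀) :=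
    hρ3.trans (mul_le_mul_of_nonneg_right (by linarith only [hq.αF_pos]) hδpos.le)
  have hρ0 : δ12₀ ≤ (1 - 2 * q.α) * q.δ₀ := hρ1.trans (mul_le_of_le_one_left hδpos.le (by linarith only [hq.αF_pos]))
  have hδle : (1 - 2 * q.α) * q.δ₀ ≤ (1 - q.α) * q.δ₀ := mul_le_mul_of_nonneg_right (by linarith only [hq.α_pos]) hq.δ₀_pos.le
  have hαδ1 : q.αF * ((1 - 2 * q.α) * q.δ₀) ≤ (1 - 2 * q.α) * q.δ₀ := mul_le_of_le_one_left hδpos.le (by linarith only [hq.αF_lt])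
  have hα2' : 2 * q.αF * ((1 - 2 * q.α) * q.δ₀) ≤ (1 - 2 * q.α) * q.δ₀ := mul_le_of_le_one_left hδpos.le (by linarith only [hq.αF_lt])
  have hα₁δ₀ : 0 ≤ q.α * q.δ₀ := mul_nonneg hq.α_pos.le hq.δ₀_pos.le
  have hrate : (1 - 2 * q.αF) * ((1 - 2 * q.α) * q.δ₀) ≤ (1 - q.α) * q.δ₀ :=
    (mul_le_of_le_one_left hδpos.le (by linarith only [hq.αF_pos])).trans hδle
  refine ⟨C, Bi, Bi2, B₂, M₀, a₀, hC, hBh0, hBi0, hBi20, hB₂0, hM₀pos, ha₀pos,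
    le_max_left _ _, min_le_left _ _, fun x hM α₀ hα ha U hU hU' => ?_, fun x hM α₀ hα ha U hU hU' => ?_,
    fun x hM α₀ hα ha U hU hU' => ?_⟩
  all_goals
    -- the member's regime: above every threshold, below both smallness bounds
    have hM12x : M12 ≤ (geo9Y x).M := le_trans (le_max_left _ _) hM
    have hMq : q.M₁ ≤ (geo9Y x).M := le_trans ((le_max_left _ _).trans (le_max_right _ _)) hM
    have hMLx : ML ≤ (geo9Y x).M := le_trans (((le_max_left _ _).trans (le_max_right _ _)).trans (le_max_right _ _)) hM
    have hM1 : 1 ≤ (geo9Y x).M :=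
      le_trans ((((le_max_left _ _).trans (le_max_right _ _)).trans (le_max_right _ _)).trans (le_max_right _ _)) hM
    have hbig : 2 * q.NF * q.θ₀ * B6.c1 dq q.δ₀ q.α ≤ (geo9Y x).M :=
      le_trans ((((((le_max_left _ _).trans (le_max_left _ _)).trans (le_max_right _ _)).trans (le_max_right _ _)).trans
        (le_max_right _ _)).trans (le_max_right _ _)) hM
    have hMbig : 2 * q.NF * q.θ₀ * Real.sqrt L₀ * B6.c1 dq q.δ₀ q.α ≤ (geo9Y x).M :=
      le_trans ((((((le_max_right _ _).trans (le_max_left _ _)).trans (le_max_right _ _)).trans (le_max_right _ _)).trans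
        (le_max_right _ _)).trans (le_max_right _ _)) hM
    have hMpos : 0 < (geo9Y x).M := lt_of_lt_of_le one_pos hM1
    have ha12x : (geo9Y x).M * α₀ ≤ a12 := ha.trans (min_le_left _ _)
    have haq : c35 * (geo9Y x).M * α₀ ≤ q.a₁ := by
      have h1 : c35 * ((geo9Y x).M * α₀) ≤ c35 * (q.a₁ / c35) :=
        mul_le_mul_of_nonneg_left (ha.trans (min_le_right _ _)) hc35.le
      rw [mul_div_cancel₀ _ hc35.ne'] at h1
      simpa only [mul_assoc] using h1
    have hq' : q.NF * (q.θ₀ * (geo9Y x).M⁻¹) * B6.c1 dq q.δ₀ q.α ≤ 1 / 2 := small_of_threshold hMpos hbig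
    have hlen : ∀ y : (geo9Y x).Site, 0 ≤ (geo9Y x).len y := fun y => (geo9Y_len_pos x y).le
    obtain ⟨hl, hf, hTd, hi⟩ := h36A x hMq α₀ hα haq U hU
    obtain ⟨hL, hFH, ⟨hL3, hRT, hDT⟩, ⟨hIL, hFI, hDH⟩, ⟨hLM, hFM, hDS⟩⟩ := h36HA x hMq α₀ hα haq U hU
    obtain ⟨hL2, hF2⟩ := h36A2 x hMq α₀ hα haq U hU
    have hc : Conv3107 (𝔬A x) 1 (H x) C ((1 - 2 * q.α) * q.δ₀) U :=
      conv3107_of_local3107₂ (𝔬A x) (𝔡A x) (𝔩A x) 1 (H x) dq q.δ₀ q.α q.ρ q.B₀ q.Nc q.N' q.NF q.Cℓ q.Kc q.θ₀ (κA x) U hq.B₀_pos.le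
        hq.δ₀_pos.le hq.α_pos.le hq.α_lt.le hq.Nc_nn hq.N'_nn hq.NF_nn hq.one_le_Cℓ hq.Kc_nn hq.θ₀_nn hMpos (hstA x) (hκA x)
        (h261 x hMLx) hq' hl hf hTd hi
    have hgeo : GeoOK (geo9Y x) := ⟨(hstA x).tri, (hstA x).symm, (hstA x).dnn, (hstA x).lenpos⟩
    have hMα : 0 ≤ (geo9Y x).M * α₀ := mul_nonneg hMpos.le hα.le
    have hL2M := thm33G0L2M_of_conv3107₃ (𝔬12 x) (𝔬A x) (𝔡A x) (𝔩A x) dF dq ((1 - 2 * q.α) * q.δ₀) q.αF L₀ q.δ₀ q.α q.ρ q.Nc q.N' q.NF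
        q.Cℓ q.N2 q.B2 q.θ2 q3.N3 q3.B3 q.θ₀ qM.NM qM.BM qM.θM C B₂ δ12₀ (κA x) (S2A x) (S3A x) (SMA x) U (hblk x) (hblkY x)
        (hG0 x U) (hD x U) (hDs x U) hq.NF_nn hq.N2_nn hq.B2_nn hq.θ2_nn hN3 hB3 hq.θ₀_nn hNM hBM hθM hM1 hC hαFδ hα2' hα₁δ₀ hrate
        hq.δ₀_pos.le hq.α_pos.le le_rfl hMbig
        ((le_max_left _ _).trans (le_max_left _ _)) ((le_max_right _ _).trans (le_max_left _ _))
        ((le_max_left _ _).trans (le_max_right _ _)) ((le_max_right _ _).trans (le_max_right _ _)) hρ3 (hstA x) (hcnt2A x)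
        (hcnt3A x) (hcntMA x) (h261 x hMLx) (hfacts x hMLx) hi hL2 hF2 hL3 hf hRT hLM hFM hDS hDT (hsymA x hMq α₀ hα haq U hU)
        (htrA x hMq α₀ hα haq U hU) hc
  · exact thm33G0_of_conv3107 (𝔬12 x) (𝔬A x) (hblk x) (hblkY x) (hG0 x U) (hDs x U) hC hρ0 (hstA x).dnn hlen hc
  · -- (3.42)₂ for G₀ from `Conv3107` (the S-leaves' `he1` input)
    exact e1_of_conv3107 (𝔬12 x) (𝔬A x) (hblk x) (hblkY x) (hG0 x U) (hD x U) hC hρ0 (hstA x).dnn hlen hc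
  · refine ⟨?_, thm33G0DirR_of_conv3107 (𝔬12 x) (𝔬A x) (𝔡A x) (hblk x) (hG0 x U) hC hρ0 (hstA x).dnn hlen hc hDS, ?_⟩
    · exact thm33G0Dir_of_conv3107₂ (𝔬12 x) (𝔬A x) (𝔡A x) (𝔩A x) (𝔭A x) (bHXA x) dF dq ((1 - 2 * q.α) * q.δ₀) q.αF L₀ q.δ₀ q.α q.ρ
        q.Nc q.N' q.NF q.Cℓ q.θ₀ q.NH q.NI C δ12₀ (κA x) (SHA x) (SIA x) q.Bl q.Bt q.BI q.θI q.BI2 U (hblk x) (hblkY x) (hG0 x U)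
        (hD x U) (hDs x U) hq.δ₀_pos.le hq.α_pos.le (by linarith only [hq.α_lt]) hq.NF_nn hq.θ₀_nn hq.NH_nn hq.NI_nn hM1 hC hδpos.le
        hδle hαFδ hαδ1 hρ1 hq.Bl_nn hq.Bt_nn hq.BI_nn hq.BI2_nn hq.θI_nn (hstA x) (hcntHA x) (hcntIA x) (h261 x hMLx) hq'
        (hfacts x hMLx) hf hi hL hFH hIL hFI hDS hDH hc
    · exact hL2M

end Summit.QuantumFields.YangMills.BalabanUVNodes.N06G0CoreFromThm310GUSPC

end
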